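import Summits.CriticalPhenomena.PercolationContinuityZ3.Theorems.SahiMasterFamilyPointwiseCoordinateGluingAbsorbed

/-!
# One-coordinate gluing, V: the ABSORBING SHAPE with free `0`-sections — `E_3` of `(A, B, D)` when the `1`-sections of `A, B` are
# independent and `D` contains them on `{e ∈ ω}`; `C_3` and the pointwise statement inherited from the `0`-minor

Unit `prim-master-conj` (crux anchor stmt-CriticalPhenomena-4575, helper work), gen 15; memo
`run/shared/lean/prim/prim-l12/prim-master-conj/POINTWISE.md` §16.  Notation: `t = p_e`, `X^b = secAt e b X`, `m = μ_p`, `X = A¹, Y = B¹, C = D⁰,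
G = D¹`, `ν_A = m X − m A⁰`, `ν_B = m Y − m B⁰`, `N_A = X ∖ A⁰`, `N_B = Y ∖ B⁰`.

THE CLASS: increasing `A, B, D`, a coordinate `e`, `A¹ ⟂ B¹` (determining sets `F / Fᶜ`) and `D¹ ⊇ A¹ ∪ B¹`.  NOTHING is assumed about the
`0`-sections `A⁰ ⊆ A¹, B⁰ ⊆ B¹, C ⊆ G` (this is what distinguishes the file from parts III–IV, and it contains part I's (B) as the case `B¹ = Ω`).
THE IDENTITY (`sahiE_three_absorbing_eq`):
  `E_3(A, B, D) = (1−t)²·E_3(A⁰, B⁰, C) + t(1−t)·M + t(1−t)²·(m G − m C)·ν_A ν_B`,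
  `M = Cov(X, B⁰∩C) + Cov(Y, A⁰∩C) + m(N_A ∩ B⁰ ∩ Cᶜ) + m(A⁰ ∩ N_B ∩ Cᶜ) + m(N_A ∩ N_B) + (1 − m G)·[ν_A ν_B + Cov(A⁰, B⁰)]`,
a `ring` identity after conditioning on `e`, `m(X∩Y) = m X·m Y` and `X, Y ⊆ G`; every term of `M` is a Harris covariance of increasing events or a
probability (the cells in inclusion–exclusion form, `absorbing_cell₁/₂/₃`).  CONSEQUENCES: `sahiE_three_absorbing_nonneg` — `C_3` for `(A,B,D)` from
`E_3(A⁰,B⁰,C) ≥ 0`; `sahiE_three_absorbing_settled` — settledness of `(A,B,D)` at every interior `p` from settledness of the `0`-minor.  With the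
`0`-minor a zero flag this settles ALL 77 non-degenerate classes of the `n = 5` good-coordinate census (memo §16), completing that frontier.
HONEST FRAMING: an inheritance theorem; Kahn's Conjecture 5 / `MasterFamilyEqIff 3` remain OPEN.  Axioms standard. [this work]
-/

noncomputable section

open scoped Classical

namespace Summit.CriticalPhenomena.PercolationContinuityZ3.Theorems

open Finset Function
open Literature.Combinatorics.Sahi2008
open Literature.Probability.Percolation (DeterminedBy)
open Literature.Probability.Percolation.DecisionTree (ind ind_of_mem ind_of_not_mem ind_nonneg)
open SahiCombDisjunct

namespace Pointwise

variable {ι : Type} [Fintype ι]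

/-! ### 0. The three cells in inclusion–exclusion form -/

/-- `m((X∖A) ∩ B ∩ Cᶜ) = m(X∩B) − m(X∩B∩C) − m(A∩B) + m(A∩B∩C)` for `A ⊆ X`. [folklore] -/
theorem absorbing_cell₁ (μ : Set ι → ℝ) {A X : Set (Set ι)} (hAX : A ⊆ X) (B C : Set (Set ι)) :
    ex μ (ind ((X \ A) ∩ B ∩ Cᶜ)) = ex μ (ind (X ∩ B)) - ex μ (ind (X ∩ B ∩ C)) - ex μ (ind (A ∩ B)) + ex μ (ind (A ∩ B ∩ C)) := by
  have h : ind ((X \ A) ∩ B ∩ Cᶜ) = ind (X ∩ B) - ind (X ∩ B ∩ C) - ind (A ∩ B) + ind (A ∩ B ∩ C) := by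
    funext ω
    simp only [Pi.add_apply, Pi.sub_apply, Literature.Probability.Percolation.BHK2006.ind_inter, ind_compl_apply, ind_sdiff_of_subset hAX]
    ring
  rw [h, ex_add, ex_sub', ex_sub']

/-- `m(A ∩ (Y∖B) ∩ Cᶜ) = m(Y∩A) − m(Y∩A∩C) − m(A∩B) + m(A∩B∩C)` for `B ⊆ Y`. [folklore] -/
theorem absorbing_cell₂ (μ : Set ι → ℝ) (A : Set (Set ι)) {B Y : Set (Set ι)} (hBY : B ⊆ Y) (C : Set (Set ι)) :
    ex μ (ind (A ∩ (Y \ B) ∩ Cᶜ)) = ex μ (ind (Y ∩ A)) - ex μ (ind (Y ∩ A ∩ C)) - ex μ (ind (A ∩ B)) + ex μ (ind (A ∩ B ∩ C)) := by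
  have h : ind (A ∩ (Y \ B) ∩ Cᶜ) = ind (Y ∩ A) - ind (Y ∩ A ∩ C) - ind (A ∩ B) + ind (A ∩ B ∩ C) := by
    funext ω
    simp only [Pi.add_apply, Pi.sub_apply, Literature.Probability.Percolation.BHK2006.ind_inter, ind_compl_apply, ind_sdiff_of_subset hBY]
    ring
  rw [h, ex_add, ex_sub', ex_sub']

/-- `m((X∖A) ∩ (Y∖B)) = m(X∩Y) − m(X∩B) − m(Y∩A) + m(A∩B)` for `A ⊆ X`, `B ⊆ Y`. [folklore] -/
theorem absorbing_cell₃ (μ : Set ι → ℝ) {A X B Y : Set (Set ι)} (hAX : A ⊆ X) (hBY : B ⊆ Y) :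
    ex μ (ind ((X \ A) ∩ (Y \ B))) = ex μ (ind (X ∩ Y)) - ex μ (ind (X ∩ B)) - ex μ (ind (Y ∩ A)) + ex μ (ind (A ∩ B)) := by
  have h : ind ((X \ A) ∩ (Y \ B)) = ind (X ∩ Y) - ind (X ∩ B) - ind (Y ∩ A) + ind (A ∩ B) := by
    funext ω
    simp only [Pi.add_apply, Pi.sub_apply, Literature.Probability.Percolation.BHK2006.ind_inter, ind_sdiff_of_subset hAX, ind_sdiff_of_subset hBY]
    ring
  rw [h, ex_add, ex_sub', ex_sub']

/-! ### 1. The identity -/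

section Absorbing

variable (p : ι → unitInterval) (e : ι) (F : Finset ι) (A B D : Set (Set ι))
  (hA1 : DeterminedBy (secAt e true A) (↑F : Set ι)) (hB1 : DeterminedBy (secAt e true B) (↑F : Set ι)ᶜ)
  (hDA : secAt e true A ⊆ secAt e true D) (hDB : secAt e true B ⊆ secAt e true D)
include hA1 hB1 hDA hDB

/-- **Identity (F), the absorbing shape with free `0`-sections** (file header; the cells of `M` written in inclusion–exclusion form, cf.
`absorbing_cell₁/₂/₃`, with `m(X ∩ Y) = m X·m Y`). [this work] -/
theorem sahiE_three_absorbing_eq :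
    sahiE (bernoulliWeight p) 3 ![ind A, ind B, ind D] =
      (1 - (p e : ℝ)) ^ 2 * sahiE (bernoulliWeight p) 3 ![ind (secAt e false A), ind (secAt e false B), ind (secAt e false D)]
      + (p e : ℝ) * (1 - (p e : ℝ)) *
        ((ex (bernoulliWeight p) (ind (secAt e true A ∩ secAt e false B ∩ secAt e false D)) -
            ex (bernoulliWeight p) (ind (secAt e true A)) * ex (bernoulliWeight p) (ind (secAt e false B ∩ secAt e false D)))
          + (ex (bernoulliWeight p) (ind (secAt e true B ∩ secAt e false A ∩ secAt e false D)) -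
            ex (bernoulliWeight p) (ind (secAt e true B)) * ex (bernoulliWeight p) (ind (secAt e false A ∩ secAt e false D)))
          + (ex (bernoulliWeight p) (ind (secAt e true A ∩ secAt e false B))
              - ex (bernoulliWeight p) (ind (secAt e true A ∩ secAt e false B ∩ secAt e false D))
              - ex (bernoulliWeight p) (ind (secAt e false A ∩ secAt e false B))
              + ex (bernoulliWeight p) (ind (secAt e false A ∩ secAt e false B ∩ secAt e false D)))
          + (ex (bernoulliWeight p) (ind (secAt e true B ∩ secAt e false A))
              - ex (bernoulliWeight p) (ind (secAt e true B ∩ secAt e false A ∩ secAt e false D))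
              - ex (bernoulliWeight p) (ind (secAt e false A ∩ secAt e false B))
              + ex (bernoulliWeight p) (ind (secAt e false A ∩ secAt e false B ∩ secAt e false D)))
          + (ex (bernoulliWeight p) (ind (secAt e true A)) * ex (bernoulliWeight p) (ind (secAt e true B))
              - ex (bernoulliWeight p) (ind (secAt e true A ∩ secAt e false B))
              - ex (bernoulliWeight p) (ind (secAt e true B ∩ secAt e false A))
              + ex (bernoulliWeight p) (ind (secAt e false A ∩ secAt e false B)))
          + (1 - ex (bernoulliWeight p) (ind (secAt e true D))) *
            ((ex (bernoulliWeight p) (ind (secAt e true A)) - ex (bernoulliWeight p) (ind (secAt e false A))) *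
                (ex (bernoulliWeight p) (ind (secAt e true B)) - ex (bernoulliWeight p) (ind (secAt e false B)))
              + (ex (bernoulliWeight p) (ind (secAt e false A ∩ secAt e false B)) -
                ex (bernoulliWeight p) (ind (secAt e false A)) * ex (bernoulliWeight p) (ind (secAt e false B)))))
      + (p e : ℝ) * (1 - (p e : ℝ)) ^ 2 *
        ((ex (bernoulliWeight p) (ind (secAt e true D)) - ex (bernoulliWeight p) (ind (secAt e false D))) *
          ((ex (bernoulliWeight p) (ind (secAt e true A)) - ex (bernoulliWeight p) (ind (secAt e false A))) *
            (ex (bernoulliWeight p) (ind (secAt e true B)) - ex (bernoulliWeight p) (ind (secAt e false B))))) := by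
  have hAe : ex (bernoulliWeight p) (ind A) = (p e : ℝ) * ex (bernoulliWeight p) (ind (secAt e true A)) +
      (1 - (p e : ℝ)) * ex (bernoulliWeight p) (ind (secAt e false A)) := ex_ind_eq_secAt p e A
  have hBe : ex (bernoulliWeight p) (ind B) = (p e : ℝ) * ex (bernoulliWeight p) (ind (secAt e true B)) +
      (1 - (p e : ℝ)) * ex (bernoulliWeight p) (ind (secAt e false B)) := ex_ind_eq_secAt p e B
  have hDe : ex (bernoulliWeight p) (ind D) = (p e : ℝ) * ex (bernoulliWeight p) (ind (secAt e true D)) +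
      (1 - (p e : ℝ)) * ex (bernoulliWeight p) (ind (secAt e false D)) := ex_ind_eq_secAt p e D
  have hAB : ex (bernoulliWeight p) (ind (A ∩ B)) = (p e : ℝ) * ex (bernoulliWeight p) (ind (secAt e true A ∩ secAt e true B)) +
      (1 - (p e : ℝ)) * ex (bernoulliWeight p) (ind (secAt e false A ∩ secAt e false B)) := by
    rw [ex_ind_eq_secAt p e (A ∩ B), secAt_inter, secAt_inter]
  have hAD : ex (bernoulliWeight p) (ind (A ∩ D)) = (p e : ℝ) * ex (bernoulliWeight p) (ind (secAt e true A ∩ secAt e true D)) +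
      (1 - (p e : ℝ)) * ex (bernoulliWeight p) (ind (secAt e false A ∩ secAt e false D)) := by
    rw [ex_ind_eq_secAt p e (A ∩ D), secAt_inter, secAt_inter]
  have hBD : ex (bernoulliWeight p) (ind (B ∩ D)) = (p e : ℝ) * ex (bernoulliWeight p) (ind (secAt e true B ∩ secAt e true D)) +
      (1 - (p e : ℝ)) * ex (bernoulliWeight p) (ind (secAt e false B ∩ secAt e false D)) := by
    rw [ex_ind_eq_secAt p e (B ∩ D), secAt_inter, secAt_inter]
  have hABD : ex (bernoulliWeight p) (ind (A ∩ B ∩ D)) =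
      (p e : ℝ) * ex (bernoulliWeight p) (ind (secAt e true A ∩ secAt e true B ∩ secAt e true D)) +
      (1 - (p e : ℝ)) * ex (bernoulliWeight p) (ind (secAt e false A ∩ secAt e false B ∩ secAt e false D)) := by
    rw [ex_ind_eq_secAt p e (A ∩ B ∩ D), secAt_inter, secAt_inter, secAt_inter, secAt_inter]
  have f11 : ex (bernoulliWeight p) (ind (secAt e true A ∩ secAt e true B)) =
      ex (bernoulliWeight p) (ind (secAt e true A)) * ex (bernoulliWeight p) (ind (secAt e true B)) :=
    ex_ind_inter_of_separated p F hA1 hB1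
  have g1 : ex (bernoulliWeight p) (ind (secAt e true A ∩ secAt e true D)) = ex (bernoulliWeight p) (ind (secAt e true A)) :=
    ex_ind_inter_of_subset _ hDA
  have g2 : ex (bernoulliWeight p) (ind (secAt e true B ∩ secAt e true D)) = ex (bernoulliWeight p) (ind (secAt e true B)) :=
    ex_ind_inter_of_subset _ hDB
  have g3 : ex (bernoulliWeight p) (ind (secAt e true A ∩ secAt e true B ∩ secAt e true D)) =
      ex (bernoulliWeight p) (ind (secAt e true A)) * ex (bernoulliWeight p) (ind (secAt e true B)) := by
    rw [Set.inter_eq_left.2 (Set.inter_subset_left.trans hDA), f11]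
  rw [sahiE_three, sahiE_three]
  simp only [ind_mul_ind_eq_inter]
  rw [hAe, hBe, hDe, hAB, hAD, hBD, hABD, f11, g1, g2, g3]
  ring

variable (hAu : IsUpperSet A) (hBu : IsUpperSet B) (hDu : IsUpperSet D)
include hAu hBu hDu

/-- **`C_3` is inherited from the `0`-minor on the absorbing shape**: `E_3(μ_p; A⁰, B⁰, C) ≥ 0 ⟹ E_3(μ_p; A, B, D) ≥ 0`. [this work] -/
theorem sahiE_three_absorbing_nonneg
    (h0 : 0 ≤ sahiE (bernoulliWeight p) 3 ![ind (secAt e false A), ind (secAt e false B), ind (secAt e false D)]) :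
    0 ≤ sahiE (bernoulliWeight p) 3 ![ind A, ind B, ind D] := by
  rw [sahiE_three_absorbing_eq p e F A B D hA1 hB1 hDA hDB]
  have ht0 : 0 ≤ (p e : ℝ) := (p e).2.1
  have ht1 : 0 ≤ 1 - (p e : ℝ) := sub_nonneg.2 (p e).2.2
  have hA0u := isUpperSet_secAt e false hAu
  have hA1u := isUpperSet_secAt e true hAu
  have hB0u := isUpperSet_secAt e false hBu
  have hB1u := isUpperSet_secAt e true hBu
  have hC := isUpperSet_secAt e false hDu
  have sA := RigidityAll.secAt_false_subset_secAt_true e hAu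
  have sB := RigidityAll.secAt_false_subset_secAt_true e hBu
  have c1 : 0 ≤ ex (bernoulliWeight p) (ind (secAt e true A ∩ secAt e false B ∩ secAt e false D)) -
      ex (bernoulliWeight p) (ind (secAt e true A)) * ex (bernoulliWeight p) (ind (secAt e false B ∩ secAt e false D)) := by
    rw [Set.inter_assoc]; exact cov_ind_nonneg p hA1u (hB0u.inter hC)
  have c2 : 0 ≤ ex (bernoulliWeight p) (ind (secAt e true B ∩ secAt e false A ∩ secAt e false D)) -
      ex (bernoulliWeight p) (ind (secAt e true B)) * ex (bernoulliWeight p) (ind (secAt e false A ∩ secAt e false D)) := by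
    rw [Set.inter_assoc]; exact cov_ind_nonneg p hB1u (hA0u.inter hC)
  have m1 : 0 ≤ ex (bernoulliWeight p) (ind (secAt e true A ∩ secAt e false B))
      - ex (bernoulliWeight p) (ind (secAt e true A ∩ secAt e false B ∩ secAt e false D))
      - ex (bernoulliWeight p) (ind (secAt e false A ∩ secAt e false B))
      + ex (bernoulliWeight p) (ind (secAt e false A ∩ secAt e false B ∩ secAt e false D)) := by
    rw [← absorbing_cell₁ _ sA]; exact ex_ind_nonneg' p _
  have m2 : 0 ≤ ex (bernoulliWeight p) (ind (secAt e true B ∩ secAt e false A))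
      - ex (bernoulliWeight p) (ind (secAt e true B ∩ secAt e false A ∩ secAt e false D))
      - ex (bernoulliWeight p) (ind (secAt e false A ∩ secAt e false B))
      + ex (bernoulliWeight p) (ind (secAt e false A ∩ secAt e false B ∩ secAt e false D)) := by
    rw [← absorbing_cell₂ _ _ sB]; exact ex_ind_nonneg' p _
  have m3 : 0 ≤ ex (bernoulliWeight p) (ind (secAt e true A)) * ex (bernoulliWeight p) (ind (secAt e true B))
      - ex (bernoulliWeight p) (ind (secAt e true A ∩ secAt e false B))
      - ex (bernoulliWeight p) (ind (secAt e true B ∩ secAt e false A))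
      + ex (bernoulliWeight p) (ind (secAt e false A ∩ secAt e false B)) := by
    rw [← ex_ind_inter_of_separated p F hA1 hB1, ← absorbing_cell₃ _ sA sB]; exact ex_ind_nonneg' p _
  have nA := ex_secAt_true_sub_false_nonneg p e hAu
  have nB := ex_secAt_true_sub_false_nonneg p e hBu
  have nD := ex_secAt_true_sub_false_nonneg p e hDu
  have cAB := cov_ind_nonneg p hA0u hB0u
  have gG : 0 ≤ 1 - ex (bernoulliWeight p) (ind (secAt e true D)) := by rw [one_sub_ex_ind]; exact ex_ind_nonneg' p _
  have nn := mul_nonneg nA nB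
  have t0 := mul_nonneg (pow_nonneg ht1 2) h0
  have t1 := mul_nonneg (mul_nonneg ht0 ht1)
    (add_nonneg (add_nonneg (add_nonneg (add_nonneg (add_nonneg c1 c2) m1) m2) m3) (mul_nonneg gG (add_nonneg nn cAB)))
  have t2 := mul_nonneg (mul_nonneg ht0 (pow_nonneg ht1 2)) (mul_nonneg nD nn)
  linarith

/-- **Settledness is inherited from the `0`-minor on the absorbing shape**: if `(A⁰, B⁰, C)` is settled on the open cube then at every interior
`p`, `E_3(μ_p; A, B, D) = 0 ↔ (A, B, D) ∈ Z_3` (positivity is the previous theorem). [this work] -/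
theorem sahiE_three_absorbing_settled {p : ι → unitInterval} (hp : ∀ f, (p f : ℝ) ∈ Set.Ioo (0 : ℝ) 1)
    (hS : ∀ r : ι → unitInterval, (∀ f, (r f : ℝ) ∈ Set.Ioo (0 : ℝ) 1) →
      0 ≤ sahiE (bernoulliWeight r) 3 ![ind (secAt e false A), ind (secAt e false B), ind (secAt e false D)] ∧
        (sahiE (bernoulliWeight r) 3 ![ind (secAt e false A), ind (secAt e false B), ind (secAt e false D)] = 0 →
          SuppZeroFlag 3 ![secAt e false A, secAt e false B, secAt e false D])) :
    sahiE (bernoulliWeight p) 3 (fun j => ind ((![A, B, D] : Fin 3 → Set (Set ι)) j)) = 0 ↔ SuppZeroFlag 3 ![A, B, D] := by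
  have hU : ∀ j, IsUpperSet ((![A, B, D] : Fin 3 → Set (Set ι)) j) := by
    intro j; fin_cases j
    · exact hAu
    · exact hBu
    · exact hDu
  have hv : (fun j => ind ((![A, B, D] : Fin 3 → Set (Set ι)) j)) = ![ind A, ind B, ind D] := by
    funext j; fin_cases j <;> rfl
  have hv0 : (fun j => ind ((![secAt e false A, secAt e false B, secAt e false D] : Fin 3 → Set (Set ι)) j)) =
      ![ind (secAt e false A), ind (secAt e false B), ind (secAt e false D)] := by
    funext j; fin_cases j <;> rfl
  rw [hv]
  refine ⟨fun hz => ?_, fun hZ => ?_⟩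
  swap
  · have := masterFamilyEqIff_mpr 3 ι p _ hZ; rwa [hv] at this
  refine suppZeroFlag_of_eq_zero_on_paramBox _ hU (a := fun _ => 0) (b := fun _ => 1) (fun _ => zero_lt_one) (fun _ => le_rfl)
    (fun _ => le_rfl) fun q hq => ?_
  rw [hv]
  have ht0 : 0 < (p e : ℝ) := (hp e).1
  have ht1 : 0 < 1 - (p e : ℝ) := sub_pos.2 (hp e).2
  have hA0u := isUpperSet_secAt e false hAu
  have hA1u := isUpperSet_secAt e true hAu
  have hB0u := isUpperSet_secAt e false hBu
  have hB1u := isUpperSet_secAt e true hBu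
  have hC := isUpperSet_secAt e false hDu
  have sA := RigidityAll.secAt_false_subset_secAt_true e hAu
  have sB := RigidityAll.secAt_false_subset_secAt_true e hBu
  have h0 := (hS p hp).1
  have c1 : 0 ≤ ex (bernoulliWeight p) (ind (secAt e true A ∩ secAt e false B ∩ secAt e false D)) -
      ex (bernoulliWeight p) (ind (secAt e true A)) * ex (bernoulliWeight p) (ind (secAt e false B ∩ secAt e false D)) := by
    rw [Set.inter_assoc]; exact cov_ind_nonneg p hA1u (hB0u.inter hC)
  have c2 : 0 ≤ ex (bernoulliWeight p) (ind (secAt e true B ∩ secAt e false A ∩ secAt e false D)) -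
      ex (bernoulliWeight p) (ind (secAt e true B)) * ex (bernoulliWeight p) (ind (secAt e false A ∩ secAt e false D)) := by
    rw [Set.inter_assoc]; exact cov_ind_nonneg p hB1u (hA0u.inter hC)
  have m1 : 0 ≤ ex (bernoulliWeight p) (ind (secAt e true A ∩ secAt e false B))
      - ex (bernoulliWeight p) (ind (secAt e true A ∩ secAt e false B ∩ secAt e false D))
      - ex (bernoulliWeight p) (ind (secAt e false A ∩ secAt e false B))
      + ex (bernoulliWeight p) (ind (secAt e false A ∩ secAt e false B ∩ secAt e false D)) := by
    rw [← absorbing_cell₁ _ sA]; exact ex_ind_nonneg' p _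
  have m2 : 0 ≤ ex (bernoulliWeight p) (ind (secAt e true B ∩ secAt e false A))
      - ex (bernoulliWeight p) (ind (secAt e true B ∩ secAt e false A ∩ secAt e false D))
      - ex (bernoulliWeight p) (ind (secAt e false A ∩ secAt e false B))
      + ex (bernoulliWeight p) (ind (secAt e false A ∩ secAt e false B ∩ secAt e false D)) := by
    rw [← absorbing_cell₂ _ _ sB]; exact ex_ind_nonneg' p _
  have m3 : 0 ≤ ex (bernoulliWeight p) (ind (secAt e true A)) * ex (bernoulliWeight p) (ind (secAt e true B))
      - ex (bernoulliWeight p) (ind (secAt e true A ∩ secAt e false B))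
      - ex (bernoulliWeight p) (ind (secAt e true B ∩ secAt e false A))
      + ex (bernoulliWeight p) (ind (secAt e false A ∩ secAt e false B)) := by
    rw [← ex_ind_inter_of_separated p F hA1 hB1, ← absorbing_cell₃ _ sA sB]; exact ex_ind_nonneg' p _
  have nA := ex_secAt_true_sub_false_nonneg p e hAu
  have nB := ex_secAt_true_sub_false_nonneg p e hBu
  have nD := ex_secAt_true_sub_false_nonneg p e hDu
  have cAB := cov_ind_nonneg p hA0u hB0u
  have gG : 0 ≤ 1 - ex (bernoulliWeight p) (ind (secAt e true D)) := by rw [one_sub_ex_ind]; exact ex_ind_nonneg' p _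
  have nn := mul_nonneg nA nB
  have p6 := mul_nonneg gG (add_nonneg nn cAB)
  have p7 := mul_nonneg nD nn
  have hz' := hz
  rw [sahiE_three_absorbing_eq p e F A B D hA1 hB1 hDA hDB] at hz'
  have w0 := mul_nonneg (pow_nonneg ht1.le 2) h0
  have w1 := mul_nonneg (mul_nonneg ht0.le ht1.le) (add_nonneg (add_nonneg (add_nonneg (add_nonneg (add_nonneg c1 c2) m1) m2) m3) p6)
  have w2 := mul_nonneg (mul_nonneg ht0.le (pow_nonneg ht1.le 2)) p7
  have s0 : (1 - (p e : ℝ)) ^ 2 * sahiE (bernoulliWeight p) 3 ![ind (secAt e false A), ind (secAt e false B), ind (secAt e false D)] = 0 := by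
    linarith
  have s1 : (p e : ℝ) * (1 - (p e : ℝ)) *
      ((ex (bernoulliWeight p) (ind (secAt e true A ∩ secAt e false B ∩ secAt e false D)) -
          ex (bernoulliWeight p) (ind (secAt e true A)) * ex (bernoulliWeight p) (ind (secAt e false B ∩ secAt e false D)))
        + (ex (bernoulliWeight p) (ind (secAt e true B ∩ secAt e false A ∩ secAt e false D)) -
          ex (bernoulliWeight p) (ind (secAt e true B)) * ex (bernoulliWeight p) (ind (secAt e false A ∩ secAt e false D)))
        + (ex (bernoulliWeight p) (ind (secAt e true A ∩ secAt e false B))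
            - ex (bernoulliWeight p) (ind (secAt e true A ∩ secAt e false B ∩ secAt e false D))
            - ex (bernoulliWeight p) (ind (secAt e false A ∩ secAt e false B))
            + ex (bernoulliWeight p) (ind (secAt e false A ∩ secAt e false B ∩ secAt e false D)))
        + (ex (bernoulliWeight p) (ind (secAt e true B ∩ secAt e false A))
            - ex (bernoulliWeight p) (ind (secAt e true B ∩ secAt e false A ∩ secAt e false D))
            - ex (bernoulliWeight p) (ind (secAt e false A ∩ secAt e false B))
            + ex (bernoulliWeight p) (ind (secAt e false A ∩ secAt e false B ∩ secAt e false D)))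
        + (ex (bernoulliWeight p) (ind (secAt e true A)) * ex (bernoulliWeight p) (ind (secAt e true B))
            - ex (bernoulliWeight p) (ind (secAt e true A ∩ secAt e false B))
            - ex (bernoulliWeight p) (ind (secAt e true B ∩ secAt e false A))
            + ex (bernoulliWeight p) (ind (secAt e false A ∩ secAt e false B)))
        + (1 - ex (bernoulliWeight p) (ind (secAt e true D))) *
          ((ex (bernoulliWeight p) (ind (secAt e true A)) - ex (bernoulliWeight p) (ind (secAt e false A))) *
              (ex (bernoulliWeight p) (ind (secAt e true B)) - ex (bernoulliWeight p) (ind (secAt e false B)))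
            + (ex (bernoulliWeight p) (ind (secAt e false A ∩ secAt e false B)) -
              ex (bernoulliWeight p) (ind (secAt e false A)) * ex (bernoulliWeight p) (ind (secAt e false B))))) = 0 := by
    linarith
  have s2 : (p e : ℝ) * (1 - (p e : ℝ)) ^ 2 *
      ((ex (bernoulliWeight p) (ind (secAt e true D)) - ex (bernoulliWeight p) (ind (secAt e false D))) *
        ((ex (bernoulliWeight p) (ind (secAt e true A)) - ex (bernoulliWeight p) (ind (secAt e false A))) *
          (ex (bernoulliWeight p) (ind (secAt e true B)) - ex (bernoulliWeight p) (ind (secAt e false B))))) = 0 := by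
    linarith
  have z0 : sahiE (bernoulliWeight p) 3 ![ind (secAt e false A), ind (secAt e false B), ind (secAt e false D)] = 0 :=
    (mul_eq_zero.1 s0).resolve_left (pow_ne_zero 2 ht1.ne')
  have s1' := (mul_eq_zero.1 s1).resolve_left (mul_ne_zero ht0.ne' ht1.ne')
  have s2' := (mul_eq_zero.1 s2).resolve_left (mul_ne_zero ht0.ne' (pow_ne_zero 2 ht1.ne'))
  have z1 : ex (bernoulliWeight p) (ind (secAt e true A ∩ secAt e false B ∩ secAt e false D)) -
      ex (bernoulliWeight p) (ind (secAt e true A)) * ex (bernoulliWeight p) (ind (secAt e false B ∩ secAt e false D)) = 0 := by linarith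
  have z2 : ex (bernoulliWeight p) (ind (secAt e true B ∩ secAt e false A ∩ secAt e false D)) -
      ex (bernoulliWeight p) (ind (secAt e true B)) * ex (bernoulliWeight p) (ind (secAt e false A ∩ secAt e false D)) = 0 := by linarith
  have z3 : ex (bernoulliWeight p) (ind (secAt e true A ∩ secAt e false B))
      - ex (bernoulliWeight p) (ind (secAt e true A ∩ secAt e false B ∩ secAt e false D))
      - ex (bernoulliWeight p) (ind (secAt e false A ∩ secAt e false B))
      + ex (bernoulliWeight p) (ind (secAt e false A ∩ secAt e false B ∩ secAt e false D)) = 0 := by linarith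
  have z4 : ex (bernoulliWeight p) (ind (secAt e true B ∩ secAt e false A))
      - ex (bernoulliWeight p) (ind (secAt e true B ∩ secAt e false A ∩ secAt e false D))
      - ex (bernoulliWeight p) (ind (secAt e false A ∩ secAt e false B))
      + ex (bernoulliWeight p) (ind (secAt e false A ∩ secAt e false B ∩ secAt e false D)) = 0 := by linarith
  have z5 : ex (bernoulliWeight p) (ind (secAt e true A)) * ex (bernoulliWeight p) (ind (secAt e true B))
      - ex (bernoulliWeight p) (ind (secAt e true A ∩ secAt e false B))
      - ex (bernoulliWeight p) (ind (secAt e true B ∩ secAt e false A))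
      + ex (bernoulliWeight p) (ind (secAt e false A ∩ secAt e false B)) = 0 := by linarith
  have z6 : (1 - ex (bernoulliWeight p) (ind (secAt e true D))) *
      ((ex (bernoulliWeight p) (ind (secAt e true A)) - ex (bernoulliWeight p) (ind (secAt e false A))) *
          (ex (bernoulliWeight p) (ind (secAt e true B)) - ex (bernoulliWeight p) (ind (secAt e false B)))
        + (ex (bernoulliWeight p) (ind (secAt e false A ∩ secAt e false B)) -
          ex (bernoulliWeight p) (ind (secAt e false A)) * ex (bernoulliWeight p) (ind (secAt e false B)))) = 0 := by linarith
  have z7 : (ex (bernoulliWeight p) (ind (secAt e true D)) - ex (bernoulliWeight p) (ind (secAt e false D))) *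
      ((ex (bernoulliWeight p) (ind (secAt e true A)) - ex (bernoulliWeight p) (ind (secAt e false A))) *
        (ex (bernoulliWeight p) (ind (secAt e true B)) - ex (bernoulliWeight p) (ind (secAt e false B)))) = 0 := s2'
  -- transfer to `q`
  have T0 : sahiE (bernoulliWeight q) 3 ![ind (secAt e false A), ind (secAt e false B), ind (secAt e false D)] = 0 := by
    have hZ : SuppZeroFlag 3 ![secAt e false A, secAt e false B, secAt e false D] := (hS p hp).2 z0
    have := masterFamilyEqIff_mpr 3 ι q _ hZ
    rwa [hv0] at this
  have T1 : ex (bernoulliWeight q) (ind (secAt e true A ∩ secAt e false B ∩ secAt e false D)) -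
      ex (bernoulliWeight q) (ind (secAt e true A)) * ex (bernoulliWeight q) (ind (secAt e false B ∩ secAt e false D)) = 0 := by
    rw [Set.inter_assoc] at z1 ⊢; exact cov_ind_eq_zero_transfer hp q hA1u (hB0u.inter hC) z1
  have T2 : ex (bernoulliWeight q) (ind (secAt e true B ∩ secAt e false A ∩ secAt e false D)) -
      ex (bernoulliWeight q) (ind (secAt e true B)) * ex (bernoulliWeight q) (ind (secAt e false A ∩ secAt e false D)) = 0 := by
    rw [Set.inter_assoc] at z2 ⊢; exact cov_ind_eq_zero_transfer hp q hB1u (hA0u.inter hC) z2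
  have T3 : ex (bernoulliWeight q) (ind (secAt e true A ∩ secAt e false B))
      - ex (bernoulliWeight q) (ind (secAt e true A ∩ secAt e false B ∩ secAt e false D))
      - ex (bernoulliWeight q) (ind (secAt e false A ∩ secAt e false B))
      + ex (bernoulliWeight q) (ind (secAt e false A ∩ secAt e false B ∩ secAt e false D)) = 0 := by
    rw [← absorbing_cell₁ _ sA] at z3 ⊢; exact ex_ind_eq_zero_transfer hp q _ z3
  have T4 : ex (bernoulliWeight q) (ind (secAt e true B ∩ secAt e false A))
      - ex (bernoulliWeight q) (ind (secAt e true B ∩ secAt e false A ∩ secAt e false D))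
      - ex (bernoulliWeight q) (ind (secAt e false A ∩ secAt e false B))
      + ex (bernoulliWeight q) (ind (secAt e false A ∩ secAt e false B ∩ secAt e false D)) = 0 := by
    rw [← absorbing_cell₂ _ _ sB] at z4 ⊢; exact ex_ind_eq_zero_transfer hp q _ z4
  have T5 : ex (bernoulliWeight q) (ind (secAt e true A)) * ex (bernoulliWeight q) (ind (secAt e true B))
      - ex (bernoulliWeight q) (ind (secAt e true A ∩ secAt e false B))
      - ex (bernoulliWeight q) (ind (secAt e true B ∩ secAt e false A))
      + ex (bernoulliWeight q) (ind (secAt e false A ∩ secAt e false B)) = 0 := by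
    rw [← ex_ind_inter_of_separated p F hA1 hB1, ← absorbing_cell₃ _ sA sB] at z5
    rw [← ex_ind_inter_of_separated q F hA1 hB1, ← absorbing_cell₃ _ sA sB]
    exact ex_ind_eq_zero_transfer hp q _ z5
  have T6 : (1 - ex (bernoulliWeight q) (ind (secAt e true D))) *
      ((ex (bernoulliWeight q) (ind (secAt e true A)) - ex (bernoulliWeight q) (ind (secAt e false A))) *
          (ex (bernoulliWeight q) (ind (secAt e true B)) - ex (bernoulliWeight q) (ind (secAt e false B)))
        + (ex (bernoulliWeight q) (ind (secAt e false A ∩ secAt e false B)) -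
          ex (bernoulliWeight q) (ind (secAt e false A)) * ex (bernoulliWeight q) (ind (secAt e false B)))) = 0 := by
    rcases mul_eq_zero.1 z6 with h | h
    · rw [one_sub_ex_eq_zero_transfer hp q _ h, zero_mul]
    · have hnn : (ex (bernoulliWeight p) (ind (secAt e true A)) - ex (bernoulliWeight p) (ind (secAt e false A))) *
          (ex (bernoulliWeight p) (ind (secAt e true B)) - ex (bernoulliWeight p) (ind (secAt e false B))) = 0 := by linarith
      have hcv : ex (bernoulliWeight p) (ind (secAt e false A ∩ secAt e false B)) -
          ex (bernoulliWeight p) (ind (secAt e false A)) * ex (bernoulliWeight p) (ind (secAt e false B)) = 0 := by linarith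
      have Tn : (ex (bernoulliWeight q) (ind (secAt e true A)) - ex (bernoulliWeight q) (ind (secAt e false A))) *
          (ex (bernoulliWeight q) (ind (secAt e true B)) - ex (bernoulliWeight q) (ind (secAt e false B))) = 0 := by
        rcases mul_eq_zero.1 hnn with h' | h'
        · rw [ex_secAt_sub_eq_zero_transfer hp q e hAu h', zero_mul]
        · rw [ex_secAt_sub_eq_zero_transfer hp q e hBu h', mul_zero]
      rw [Tn, cov_ind_eq_zero_transfer hp q hA0u hB0u hcv, add_zero, mul_zero]
  have T7 : (ex (bernoulliWeight q) (ind (secAt e true D)) - ex (bernoulliWeight q) (ind (secAt e false D))) *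
      ((ex (bernoulliWeight q) (ind (secAt e true A)) - ex (bernoulliWeight q) (ind (secAt e false A))) *
        (ex (bernoulliWeight q) (ind (secAt e true B)) - ex (bernoulliWeight q) (ind (secAt e false B)))) = 0 := by
    rcases mul_eq_zero.1 z7 with h | h
    · rw [ex_secAt_sub_eq_zero_transfer hp q e hDu h, zero_mul]
    · rcases mul_eq_zero.1 h with h' | h'
      · rw [ex_secAt_sub_eq_zero_transfer hp q e hAu h', zero_mul, mul_zero]
      · rw [ex_secAt_sub_eq_zero_transfer hp q e hBu h', mul_zero, mul_zero]
  rw [sahiE_three_absorbing_eq q e F A B D hA1 hB1 hDA hDB, T0, T1, T2, T3, T4, T5, T6, T7]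
  ring

end Absorbing

end Pointwise

end Summit.CriticalPhenomena.PercolationContinuityZ3.Theorems
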